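import Summits.Ventures.Crystal3D.Theorems.StickyWulffConstantPolycrystalWulffBoundGapTreeChimera
import Summits.Ventures.Crystal3D.Theorems.StickyWulffConstantPolycrystalWulffBoundMinkowskiUpper
import Summits.Ventures.Crystal3D.Theorems.StickyWulffConstantPolycrystalWulffBoundSeparated

/-!
# `PolycrystalWulffBound`, line `PolyDensity`: the rung `rung_gapTree` — every SORTED TREE of polyhedral
# grains with ARBITRARY lattices satisfies `6·2^{1/3}(√2·Vol)^{2/3} ≤ Fr + Σ_i θ_i·S_i`, where `θ_i` is
# the cdf-shift (threshold gap) of edge `i` and `S_i` a section bound at its wall (crux `stmt-Ventures-19482`)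

Route `StickyWulffConstant` of the venture `Summits/Ventures/Crystal3D`, second prover lane (poly-p2,
gen 14).  Same tree presentation as `rung_sortedTree` (gen 12: root `0`, parent map `par`, one wall plane
`{⟪x, m i⟫ = t i}` per edge with the child `i.succ` above it, localized parent clause, non-adjacent nodes
`δ`-apart), but the frames `A f` are UNRESTRICTED.  Edge `i` carries a gap `θ i ≥ 0` with the cdf-shift
hypothesis `|W(A (par i)) ∩ {s + θ i < ⟪y, m i⟫}| ≤ |W(A i.succ) ∩ {s < ⟪y, m i⟫}|` (all `s`) and a
one-sided section bound `S i` of the child at the wall (`|G i.succ ∩ {⟪x, m i⟫ < t i + h}| ≤ h·S i`,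
`h > 0`; for a polytope child with the wall as a facet, `S i` = facet area `+ ε` by `volume_facetSlab_le`).
Conclusion: `6·2^{1/3}(√2·Vol)^{2/3} ≤ Fr + Σ_i θ i·S i`.  Engine: `gapTree_chimera_lower` applied to the
children trimmed by `r·θ i` above their walls (volume loss `≤ r·(Σ θ i S i + ε)`), the Minkowski-content
upper bound `volume_chimera_texture_le`, and `r → 0`.
KNOWN SHIFT CONSTANTS (all inside the law `(c₀, c₁) = (1, ½)`): `θ = 0` for basal / vertical twin walls
and equal lattices (`rung_sortedTree`); `θ = (1/√6)·sin∠(m i, axis)` for every co-axial pair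
(`twinSectionShift_inv_sqrt_six`, cap form by complement); `θ = 1` for ANY two frames (ball sandwich +
medians — numerically the sharp value is `√5 − √3 = 0.504`, attained by a vanishing (100)-plate).
So: parent + caps / lamellar colonies with walls of ANY inclination / nested colonies / generic satellites
on facets, in any mixture, are uniform at this rung's level; what it does not reach are CYCLES of the wall
graph (junction lines, mutually touching triples) — there the same thresholds become a finite feasibility
problem (memo P-GAP-g14).
WHAT THIS IS NOT: a registered stub; cycles; the crux is not claimed.
-/

noncomputable section

open scoped BigOperators InnerProductSpace ENNReal Pointwise
open MeasureTheory Filter Set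

namespace Summit.Ventures.Crystal3D.Cruxes.PolycrystalWulffBound.PolyDensity

open Summit.Ventures.Crystal3D.Theorems
open Summit.Ventures.Crystal3D.Cruxes.TextureLiminf.TexShadow (per polytope E3)
open Literature.MathematicalPhysics.StatisticalMechanics (fccStacking barlowStacking IsHaggSeq perimeter)

/-- **Rung `rung_gapTree`** (uniform; sorted tree, arbitrary lattices, per-edge cdf-shift gaps `θ i`
charged against the wall section bounds `S i`): see the module docstring. -/
theorem rung_gapTree : let Λ : Set (EuclideanSpace ℝ (Fin 3)) := Literature.MathematicalPhysics.StatisticalMechanics.fccStacking 1 (Real.sqrt (2 / 3)); let Φ : EuclideanSpace ℝ (Fin 3) → ℝ := fun ν => Real.sqrt 2 / 4 * ∑ᶠ w ∈ {w ∈ Λ | ‖w‖ = 1}, |⟪w, ν⟫_ℝ|; let Per : Set (EuclideanSpace ℝ (Fin 3)) → Set (EuclideanSpace ℝ (Fin 3)) → ℝ := fun K S => (⨆ (ξ : EuclideanSpace ℝ (Fin 3) → EuclideanSpace ℝ (Fin 3)) (_ : ContDiff ℝ 1 ξ ∧ HasCompactSupport ξ ∧ ∀ z, ξ z ∈ K),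 ENNReal.ofReal (∫ z in S, Literature.MathematicalPhysics.StatisticalMechanics.fieldDivergence ξ z)).toReal; let ι : Set (EuclideanSpace ℝ (Fin 3)) → Set (EuclideanSpace ℝ (Fin 3)) → Set (EuclideanSpace ℝ (Fin 3)) → ℝ := fun K S₁ S₂ => (Per K S₁ + Per K S₂ - Per K (S₁ ∪ S₂)) / 2; let W : (EuclideanSpace ℝ (Fin 3) ≃ₗᵢ[ℝ] EuclideanSpace ℝ (Fin 3)) → Set (EuclideanSpace ℝ (Fin 3)) := fun A => {y | ∀ ν : EuclideanSpace ℝ (Fin 3), ⟪y, ν⟫_ℝ ≤ Φ (A.symm ν)}; let Vol : (n : ℕ) → (Fin n → Set (EuclideanSpace ℝ (Fin 3))) → ℝ := fun n G => (volume (⋃ f : Fin n, G f)).toReal; let Poly : Set (EuclideanSpace ℝ (Fin 3)) → Prop := fun S => ∃ (k : ℕ) (H : Fin k → Finset ((EuclideanSpace ℝ (Fin 3)) × ℝ)), S = ⋃ i, ⋂ p ∈ H i, {x | ⟪p.1, x⟫_ℝ < p.2}; let Fr : (n : ℕ) → (Fin n → Set (EuclideanSpace ℝ (Fin 3))) → (Fin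 n → (EuclideanSpace ℝ (Fin 3) ≃ₗᵢ[ℝ] EuclideanSpace ℝ (Fin 3))) → ℝ := fun n G A => ∑ f : Fin n, Per (W (A f)) (G f) - ∑ f, ∑ g, (if f = g then 0 else ι (W (A f)) (G f) (G g)); ∀ (N : ℕ) (par : Fin N → Fin (N + 1)), (∀ i, (par i : ℕ) ≤ i) → ∀ (m : Fin N → EuclideanSpace ℝ (Fin 3)) (t θ S : Fin N → ℝ) (G : Fin (N + 1) → Set (EuclideanSpace ℝ (Fin 3))) (A : Fin (N + 1) → (EuclideanSpace ℝ (Fin 3) ≃ₗᵢ[ℝ] EuclideanSpace ℝ (Fin 3))), (∀ f, Poly (G f)) → (∀ f, volume (G f) < ⊤) → (∀ i, ‖m i‖ = 1) → (∀ i, 0 ≤ θ i) → (∀ i (s : ℝ), volume (W (A (par i)) ∩ {y | s + θ i < ⟪y, m i⟫_ℝ}) ≤ volume (W (A i.succ) ∩ {y | s < ⟪y, m i⟫_ℝ})) → (∀ i, 0 ≤ S i) → (∀ i (h : ℝ), 0 < h → volume (G i.succ ∩ {x | ⟪x, m i⟫_ℝ < t i + h}) ≤ ENNReal.ofReal (h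 * S i)) → (∀ i, ∀ x ∈ G i.succ, t i < ⟪x, m i⟫_ℝ) → ∀ (δ : ℝ), 0 < δ → (∀ i, ∀ x ∈ G (par i), ⟪x, m i⟫_ℝ < t i ∨ ∀ y ∈ G i.succ, δ ≤ dist x y) → (∀ f g : Fin (N + 1), f ≠ g → (∀ i, ¬ (f = par i ∧ g = i.succ)) → (∀ i, ¬ (g = par i ∧ f = i.succ)) → ∀ x ∈ G f, ∀ y ∈ G g, δ ≤ dist x y) → 6 * (2 : ℝ) ^ ((1 : ℝ) / 3) * (Real.sqrt 2 * Vol (N + 1) G) ^ ((2 : ℝ) / 3) ≤ Fr (N + 1) G A + ∑ i, θ i * S i := by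
  intro Λ Φ Per ι W Vol Poly Fr N par hpar m t θ S G A hGpoly hGv hm1 hθ hshift hS0 hS hGt δ hδ hPt hsep
  classical
  show 6 * (2 : ℝ) ^ ((1 : ℝ) / 3) * (Real.sqrt 2 * (volume (⋃ f, G f)).toReal) ^ ((2 : ℝ) / 3) ≤
    (∑ f, Per (W (A f)) (G f)) - (∑ f, ∑ g, (if f = g then 0 else ι (W (A f)) (G f) (G g))) +
      ∑ i, θ i * S i
  rw [← Finset.sum_sub_distrib]
  -- disjointness of the grains
  have hadj : ∀ i, Disjoint (G (par i)) (G i.succ) := by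
    intro i
    rw [Set.disjoint_left]
    intro x hxp hxc
    rcases hPt i x hxp with h | h
    · exact lt_irrefl _ (h.trans (hGt i x hxc))
    · have h' := h x hxc
      rw [dist_self] at h'
      exact absurd h' (not_le.2 hδ)
  have hdisjG : ∀ f g, f ≠ g → Disjoint (G f) (G g) := by
    intro f g hfg
    by_cases h1 : ∃ i, f = par i ∧ g = i.succ
    · obtain ⟨i, rfl, rfl⟩ := h1
      exact hadj i
    by_cases h2 : ∃ i, g = par i ∧ f = i.succ
    · obtain ⟨i, rfl, rfl⟩ := h2
      exact (hadj i).symm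
    simp only [not_exists] at h1 h2
    exact Set.disjoint_left.2 fun x hx hx' => by
      have h := hsep f g hfg h1 h2 x hx x hx'
      rw [dist_self] at h
      exact absurd h (not_le.2 hδ)
  -- bodies
  have hWc : ∀ f, IsCompact (W (A f)) := fun f => isCompact_cruxWulffBody (A f)
  have hWv : ∀ f, Convex ℝ (W (A f)) := fun f => convex_cruxWulffBody (A f)
  have hW0 : ∀ f, (0 : E3) ∈ W (A f) := fun f => zero_mem_cruxWulffBody (A f)
  have hWs : ∀ f, -W (A f) = W (A f) := fun f => neg_cruxWulffBody_eq (A f)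
  have hFr0 : 0 ≤ ∑ f, (Per (W (A f)) (G f) - ∑ g, (if f = g then 0 else ι (W (A f)) (G f) (G g))) := by
    have h := freeEnergy_ge_mul_perimeter G hGpoly hGv hdisjG (fun f => W (A f)) hWc hWv hW0 hWs
      (Real.sqrt_pos.2 (by norm_num : (0:ℝ) < 3)) (fun f => closedBall_subset_cruxWulffBody (A f))
    exact le_trans (mul_nonneg (Real.sqrt_nonneg 3) ENNReal.toReal_nonneg) h
  set Θ : ℝ := ∑ i, θ i * S i with hΘ
  have hΘ0 : 0 ≤ Θ := Finset.sum_nonneg fun i _ => mul_nonneg (hθ i) (hS0 i)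
  set V : ℝ := (volume (⋃ f, G f)).toReal with hV
  have hV0 : 0 ≤ V := ENNReal.toReal_nonneg
  set F : ℝ := ∑ f, (Per (W (A f)) (G f) - ∑ g, (if f = g then 0 else ι (W (A f)) (G f) (G g))) with hF
  have hopen : ∀ S' : Set E3, (∃ (k' : ℕ) (H : Fin k' → Finset (E3 × ℝ)), S' = ⋃ i, polytope (H i)) →
      IsOpen S' := by
    rintro S' ⟨k', H, rfl⟩
    exact isOpen_iUnion fun i => isOpen_biInter_finset fun q _ =>
      isOpen_lt (continuous_const.inner continuous_id) continuous_const
  have hGo : ∀ f, IsOpen (G f) := fun f => hopen _ (hGpoly f)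
  have hE'top : volume (⋃ f, G f) ≠ ⊤ := by
    refine (lt_of_le_of_lt (measure_iUnion_le _) ?_).ne
    rw [tsum_fintype]
    exact ENNReal.sum_lt_top.2 fun f _ => hGv f
  by_cases hE'0 : volume (⋃ f, G f) = 0
  · have hV00 : V = 0 := by rw [hV, hE'0, ENNReal.toReal_zero]
    rw [hV00, mul_zero, Real.zero_rpow (by norm_num), mul_zero]
    linarith
  have hVpos : 0 < V := ENNReal.toReal_pos hE'0 hE'top
  have hGbd : ∀ f, Bornology.IsBounded (G f) := by
    intro f
    obtain ⟨k', H, hGeq⟩ := hGpoly f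
    rw [hGeq]
    refine Bornology.isBounded_iUnion.2 fun i => isBounded_hPolyhedron_of_volume_lt_top (H i) ?_
    exact lt_of_le_of_lt (measure_mono (by rw [hGeq]; exact subset_iUnion (fun i => polytope (H i)) i))
      (hGv f)
  set c : ℝ := (32 : ℝ) ^ ((3 : ℝ)⁻¹) with hc
  have hc0 : 0 < c := by positivity
  set x : ℝ := V ^ ((3 : ℝ)⁻¹) with hx
  have hxpos : 0 < x := Real.rpow_pos_of_pos hVpos _
  have hx3 : x ^ 3 = V := by
    rw [hx, show ((3 : ℝ)⁻¹) = ((3 : ℕ) : ℝ)⁻¹ by norm_num]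
    exact Real.rpow_inv_natCast_pow hV0 (by norm_num)
  -- the chimera neighbourhood of radius `r`, children trimmed by `r·θ i`
  have key : ∀ ε : ℝ, 0 < ε → 3 * c * x ^ 2 ≤ F + Θ + ε := by
    intro ε hε
    set ε₁ : ℝ := ε / 3 with hε₁
    have hε₁0 : 0 < ε₁ := by positivity
    obtain ⟨r₀, hr₀, hup⟩ := volume_chimera_texture_le G hGpoly hGv hdisjG (fun f => W (A f))
      hWc hWv hW0 hWs hε₁0
    have h51 : 0 < 2 * (Real.sqrt 5 + 1) := by positivity
    set η : ℝ := ε₁ / (1 + ∑ i, S i) with hη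
    have hSsum0 : 0 ≤ ∑ i, S i := Finset.sum_nonneg fun i _ => hS0 i
    have hη0 : 0 < η := by positivity
    have hηS : η * ∑ i, S i ≤ ε₁ := by
      rw [hη, div_mul_eq_mul_div, div_le_iff₀ (by positivity)]
      have : ε₁ * ∑ i, S i ≤ ε₁ * (1 + ∑ i, S i) := mul_le_mul_of_nonneg_left (by linarith) hε₁0.le
      linarith
    -- `r`: below `r₀`, below `δ/(2(√5+1))`, and small enough for the two `O(r)` error terms
    set r₁ : ℝ := V / (2 * (Θ + ε₁ + 1)) with hr₁
    have hr₁0 : 0 < r₁ := by positivity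
    set r₂ : ℝ := ε₁ * x / (6 * c * (Θ + ε₁) + 1) with hr₂
    have hr₂0 : 0 < r₂ := by positivity
    set r : ℝ := min (min (r₀ / 2) (δ / (2 * (Real.sqrt 5 + 1)))) (min r₁ r₂) with hr
    have hr0 : 0 < r := lt_min (lt_min (by positivity) (div_pos hδ h51)) (lt_min hr₁0 hr₂0)
    have hrr₀ : r < r₀ := lt_of_le_of_lt ((min_le_left _ _).trans (min_le_left _ _)) (by linarith)
    have hrδ : r * (2 * (Real.sqrt 5 + 1)) ≤ δ := by
      have h1 : r ≤ δ / (2 * (Real.sqrt 5 + 1)) := (min_le_left _ _).trans (min_le_right _ _)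
      calc r * (2 * (Real.sqrt 5 + 1)) ≤ δ / (2 * (Real.sqrt 5 + 1)) * (2 * (Real.sqrt 5 + 1)) := by
            gcongr
        _ = δ := div_mul_cancel₀ δ h51.ne'
    have hrr₁ : r ≤ r₁ := (min_le_right _ _).trans (min_le_left _ _)
    have hrr₂ : r ≤ r₂ := (min_le_right _ _).trans (min_le_right _ _)
    -- the trimmed grains
    set G' : Fin (N + 1) → Set E3 := fun f => G f ∩ {x | ∀ j : Fin N, f = j.succ →
      t j + r * θ j < ⟪x, m j⟫_ℝ} with hG'
    have hG'sub : ∀ f, G' f ⊆ G f := fun f => inter_subset_left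
    have hG'o : ∀ f, IsOpen (G' f) := by
      intro f
      refine (hGo f).inter ?_
      have : {x : E3 | ∀ j : Fin N, f = j.succ → t j + r * θ j < ⟪x, m j⟫_ℝ} =
          ⋂ j : Fin N, {x : E3 | f = j.succ → t j + r * θ j < ⟪x, m j⟫_ℝ} := by
        ext x; simp only [mem_setOf_eq, mem_iInter]
      rw [this]
      refine isOpen_iInter_of_finite fun j => ?_
      by_cases hfj : f = j.succ
      · have : {x : E3 | f = j.succ → t j + r * θ j < ⟪x, m j⟫_ℝ} = {x : E3 | t j + r * θ j < ⟪x, m j⟫_ℝ} := by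
          ext x; simp only [mem_setOf_eq]; exact ⟨fun h => h hfj, fun h _ => h⟩
        rw [this]
        exact isOpen_lt continuous_const (continuous_id.inner continuous_const)
      · have : {x : E3 | f = j.succ → t j + r * θ j < ⟪x, m j⟫_ℝ} = univ := by
          ext x; simp only [mem_setOf_eq, mem_univ, iff_true]; exact fun h => absurd h hfj
        rw [this]; exact isOpen_univ
    have hG't : ∀ i, ∀ x ∈ G' i.succ, t i + r * θ i < ⟪x, m i⟫_ℝ := fun i x hx => hx.2 i rfl
    have hPt' : ∀ i, ∀ x ∈ G' (par i), ⟪x, m i⟫_ℝ < t i ∨ ∀ y ∈ G' i.succ, δ ≤ dist x y := by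
      intro i x hx
      rcases hPt i x (hG'sub _ hx) with h | h
      · exact Or.inl h
      · exact Or.inr fun y hy => h y (hG'sub _ hy)
    have hsep' : ∀ f g : Fin (N + 1), f ≠ g → (∀ i, ¬ (f = par i ∧ g = i.succ)) →
        (∀ i, ¬ (g = par i ∧ f = i.succ)) → ∀ x ∈ G' f, ∀ y ∈ G' g, δ ≤ dist x y :=
      fun f g hfg h1 h2 x hx y hy => hsep f g hfg h1 h2 x (hG'sub _ hx) y (hG'sub _ hy)
    -- volume of the trimmed family: `V ≤ V' + r(Θ + ε₁)`
    have hcovG : (⋃ f, G f) ⊆ (⋃ f, G' f) ∪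
        ⋃ i : Fin N, (G i.succ ∩ {x | ⟪x, m i⟫_ℝ < t i + r * (θ i + η)}) := by
      intro x hx
      obtain ⟨f, hxf⟩ := mem_iUnion.1 hx
      by_cases h : ∀ j : Fin N, f = j.succ → t j + r * θ j < ⟪x, m j⟫_ℝ
      · exact Or.inl (mem_iUnion.2 ⟨f, hxf, h⟩)
      · simp only [not_forall, not_lt] at h
        obtain ⟨j, hfj, hle⟩ := h
        subst hfj
        refine Or.inr (mem_iUnion.2 ⟨j, hxf, ?_⟩)
        show ⟪x, m j⟫_ℝ < t j + r * (θ j + η)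
        have hpos : 0 < r * η := mul_pos hr0 hη0
        have hdist : r * (θ j + η) = r * θ j + r * η := by ring
        linarith
    have hlay : ∀ i : Fin N, volume (G i.succ ∩ {x | ⟪x, m i⟫_ℝ < t i + r * (θ i + η)}) ≤
        ENNReal.ofReal (r * (θ i + η) * S i) :=
      fun i => hS i (r * (θ i + η)) (mul_pos hr0 (by linarith [hθ i]))
    have hV'top : volume (⋃ f, G' f) ≠ ⊤ :=
      (lt_of_le_of_lt (measure_mono (iUnion_mono hG'sub)) hE'top.lt_top).ne
    set V' : ℝ := (volume (⋃ f, G' f)).toReal with hV'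
    have hV'0 : 0 ≤ V' := ENNReal.toReal_nonneg
    have hVV' : V ≤ V' + r * (Θ + ε₁) := by
      have h1 : volume (⋃ f, G f) ≤ volume (⋃ f, G' f) +
          ∑ i : Fin N, ENNReal.ofReal (r * (θ i + η) * S i) :=
        (measure_mono hcovG).trans ((measure_union_le _ _).trans (add_le_add le_rfl
          ((measure_iUnion_le _).trans (by rw [tsum_fintype]; exact Finset.sum_le_sum fun i _ => hlay i))))
      have h2 := ENNReal.toReal_mono (ENNReal.add_ne_top.2 ⟨hV'top, ENNReal.sum_ne_top.2 fun i _ =>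
        ENNReal.ofReal_ne_top⟩) h1
      rw [ENNReal.toReal_add hV'top (ENNReal.sum_ne_top.2 fun i _ => ENNReal.ofReal_ne_top),
        ENNReal.toReal_sum (fun i _ => ENNReal.ofReal_ne_top)] at h2
      have h3 : ∑ i : Fin N, (ENNReal.ofReal (r * (θ i + η) * S i)).toReal =
          r * Θ + r * (η * ∑ i, S i) := by
        rw [Finset.sum_congr rfl fun i _ => ENNReal.toReal_ofReal
          (mul_nonneg (mul_nonneg hr0.le (by linarith [hθ i, hη0.le])) (hS0 i))]
        rw [hΘ, Finset.mul_sum, Finset.mul_sum, Finset.mul_sum, ← Finset.sum_add_distrib]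
        refine Finset.sum_congr rfl fun i _ => ?_
        ring
      rw [h3] at h2
      have h4 : r * (η * ∑ i, S i) ≤ r * ε₁ := mul_le_mul_of_nonneg_left hηS hr0.le
      linarith
    -- the trimmed family is not null
    have hV'pos : 0 < V' := by
      have h1 : r * (Θ + ε₁) ≤ V / 2 := by
        have h2 : r * (Θ + ε₁) ≤ r₁ * (Θ + ε₁ + 1) := by
          have : r * (Θ + ε₁) ≤ r * (Θ + ε₁ + 1) := mul_le_mul_of_nonneg_left (by linarith) hr0.le
          exact this.trans (mul_le_mul_of_nonneg_right hrr₁ (by positivity))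
        have h3 : r₁ * (Θ + ε₁ + 1) = V / 2 := by
          rw [hr₁]; field_simp
        linarith
      linarith
    have hE''0 : volume (⋃ f, G' f) ≠ 0 := by
      intro h
      rw [hV', h, ENNReal.toReal_zero] at hV'pos
      exact lt_irrefl _ hV'pos
    -- the chimera set
    set Cr : Set E3 := ⋃ f, ⋃ x ∈ G f, x +ᵥ (r • W (A f)) with hCr
    have hCfin : volume Cr ≠ ⊤ := by
      obtain ⟨R₁, hR₁⟩ := (Bornology.isBounded_iUnion.2 hGbd).subset_closedBall 0
      have hCsub : Cr ⊆ Metric.closedBall (0 : E3) (R₁ + r * Real.sqrt 5) := by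
        intro y hy
        simp only [hCr, mem_iUnion, Set.mem_vadd_set, vadd_eq_add, exists_prop] at hy
        obtain ⟨f, x', hx', w, hw, rfl⟩ := hy
        obtain ⟨w', hw', rfl⟩ := Set.mem_smul_set.1 hw
        have hx'' : ‖x'‖ ≤ R₁ := mem_closedBall_zero_iff.1 (hR₁ (mem_iUnion.2 ⟨f, hx'⟩))
        have hw'' : ‖w'‖ ≤ Real.sqrt 5 :=
          mem_closedBall_zero_iff.1 (cruxWulffBody_subset_closedBall (A f) hw')
        rw [mem_closedBall_zero_iff]
        calc ‖x' + r • w'‖ ≤ ‖x'‖ + ‖r • w'‖ := norm_add_le _ _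
          _ = ‖x'‖ + r * ‖w'‖ := by rw [norm_smul, Real.norm_of_nonneg hr0.le]
          _ ≤ R₁ + r * Real.sqrt 5 := by gcongr
      exact (lt_of_le_of_lt (measure_mono hCsub) measure_closedBall_lt_top).ne
    have hlow := gapTree_chimera_lower par hpar m t θ A hm1 hθ hshift hr0 G' hG'o hG't hδ hPt' hsep'
      hE''0 hV'top hrδ (U := Cr)
      (fun f x' hx' w hw => mem_iUnion.2 ⟨f, mem_iUnion₂.2 ⟨x', hG'sub f hx',
        Set.mem_vadd_set.2 ⟨r • w, Set.smul_mem_smul_set hw, rfl⟩⟩⟩)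
    have hupC : (volume Cr).toReal ≤ V + r * (F + ε₁) := hup r hr0 hrr₀
    have hexp : (((3 : ℕ) : ℝ)⁻¹) = (3 : ℝ)⁻¹ := by norm_num
    have h1 : V' ^ ((3 : ℝ)⁻¹) + r * c ≤ (volume Cr).toReal ^ ((3 : ℝ)⁻¹) := by
      have h := ENNReal.toReal_mono (ENNReal.rpow_ne_top_of_nonneg (by positivity) hCfin) hlow
      rw [ENNReal.toReal_add (ENNReal.rpow_ne_top_of_nonneg (by positivity) hV'top)
          (ENNReal.mul_ne_top ENNReal.ofReal_ne_top (ENNReal.rpow_ne_top_of_nonneg (by positivity)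
            ENNReal.ofReal_ne_top)),
        ENNReal.toReal_mul, ENNReal.toReal_ofReal hr0.le, ← ENNReal.toReal_rpow, ← ENNReal.toReal_rpow,
        ← ENNReal.toReal_rpow, ENNReal.toReal_ofReal (by norm_num : (0:ℝ) ≤ 32), hexp] at h
      exact h
    set y : ℝ := V' ^ ((3 : ℝ)⁻¹) with hy
    have hy0 : 0 ≤ y := by positivity
    have hy3 : y ^ 3 = V' := by
      rw [hy, show ((3 : ℝ)⁻¹) = ((3 : ℕ) : ℝ)⁻¹ by norm_num]
      exact Real.rpow_inv_natCast_pow hV'0 (by norm_num)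
    have hC3 : ((volume Cr).toReal ^ ((3 : ℝ)⁻¹)) ^ 3 = (volume Cr).toReal := by
      rw [show ((3 : ℝ)⁻¹) = ((3 : ℕ) : ℝ)⁻¹ by norm_num]
      exact Real.rpow_inv_natCast_pow ENNReal.toReal_nonneg (by norm_num)
    have h2 : (y + r * c) ^ 3 ≤ V + r * (F + ε₁) := by
      calc (y + r * c) ^ 3 ≤ ((volume Cr).toReal ^ ((3 : ℝ)⁻¹)) ^ 3 := by gcongr
        _ = (volume Cr).toReal := hC3
        _ ≤ V + r * (F + ε₁) := hupC
    -- `3 c y² ≤ F + Θ + 2ε₁`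
    have h3 : r * (3 * c * y ^ 2) ≤ r * (F + Θ + 2 * ε₁) := by
      have hrc : 0 ≤ r * c := mul_nonneg hr0.le hc0.le
      have hexp3 : y ^ 3 + 3 * y ^ 2 * (r * c) ≤ (y + r * c) ^ 3 := by
        have hcube : (y + r * c) ^ 3 = y ^ 3 + 3 * y ^ 2 * (r * c) + (3 * y * (r * c) ^ 2 + (r * c) ^ 3) := by
          ring
        have hnn : 0 ≤ 3 * y * (r * c) ^ 2 + (r * c) ^ 3 :=
          add_nonneg (mul_nonneg (mul_nonneg (by norm_num) hy0) (sq_nonneg _)) (pow_nonneg hrc 3)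
        rw [hcube]; linarith
      calc r * (3 * c * y ^ 2) = 3 * y ^ 2 * (r * c) := by ring
        _ ≤ (y + r * c) ^ 3 - y ^ 3 := by linarith [hexp3]
        _ ≤ V + r * (F + ε₁) - V' := by linarith [h2, hy3]
        _ ≤ r * (F + ε₁) + r * (Θ + ε₁) := by linarith [hVV']
        _ = r * (F + Θ + 2 * ε₁) := by ring
    have h4 : 3 * c * y ^ 2 ≤ F + Θ + 2 * ε₁ := le_of_mul_le_mul_left h3 hr0
    -- `x² ≤ y² + 2 r (Θ + ε₁)/x`
    have h5 : 3 * c * x ^ 2 ≤ 3 * c * y ^ 2 + ε₁ := by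
      by_cases hxy : x ≤ y
      · have hsq : x ^ 2 ≤ y ^ 2 := by gcongr
        have := mul_le_mul_of_nonneg_left hsq (by positivity : (0:ℝ) ≤ 3 * c)
        linarith
      · rw [not_le] at hxy
        have hd : x ^ 3 - y ^ 3 ≤ r * (Θ + ε₁) := by rw [hx3, hy3]; linarith
        have hd2 : (x - y) * x ^ 2 ≤ x ^ 3 - y ^ 3 := by
          have hid : x ^ 3 - y ^ 3 - (x - y) * x ^ 2 = y * ((x - y) * (x + y)) := by ring
          have hnn : 0 ≤ y * ((x - y) * (x + y)) :=
            mul_nonneg hy0 (mul_nonneg (by linarith) (by linarith))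
          linarith
        have hd3 : (x - y) * x ^ 2 ≤ r * (Θ + ε₁) := hd2.trans hd
        have hd4 : x - y ≤ r * (Θ + ε₁) / x ^ 2 := by
          rw [le_div_iff₀ (by positivity)]; exact hd3
        have hd5 : x ^ 2 - y ^ 2 ≤ 2 * x * (r * (Θ + ε₁) / x ^ 2) := by
          have : x ^ 2 - y ^ 2 = (x - y) * (x + y) := by ring
          rw [this]
          calc (x - y) * (x + y) ≤ (x - y) * (2 * x) :=
                mul_le_mul_of_nonneg_left (by linarith) (by linarith)
            _ ≤ r * (Θ + ε₁) / x ^ 2 * (2 * x) := by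
                exact mul_le_mul_of_nonneg_right hd4 (by positivity)
            _ = 2 * x * (r * (Θ + ε₁) / x ^ 2) := by ring
        have hd6 : 2 * x * (r * (Θ + ε₁) / x ^ 2) = 2 * r * (Θ + ε₁) / x := by
          field_simp
        rw [hd6] at hd5
        have hd7 : 3 * c * (2 * r * (Θ + ε₁) / x) ≤ ε₁ := by
          have hr' : r ≤ ε₁ * x / (6 * c * (Θ + ε₁) + 1) := hrr₂
          have hpos : 0 < 6 * c * (Θ + ε₁) + 1 := by positivity
          rw [le_div_iff₀ hpos] at hr'
          have : 3 * c * (2 * r * (Θ + ε₁) / x) = r * (6 * c * (Θ + ε₁)) / x := by ring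
          rw [this, div_le_iff₀ hxpos]
          have hstep : r * (6 * c * (Θ + ε₁)) ≤ r * (6 * c * (Θ + ε₁) + 1) :=
            mul_le_mul_of_nonneg_left (by linarith) hr0.le
          linarith
        have hd8 : 3 * c * (x ^ 2 - y ^ 2) ≤ 3 * c * (2 * r * (Θ + ε₁) / x) :=
          mul_le_mul_of_nonneg_left hd5 (by positivity)
        have hd9 : 3 * c * (x ^ 2 - y ^ 2) = 3 * c * x ^ 2 - 3 * c * y ^ 2 := by ring
        linarith [hd8, hd7, hd9]
    have : 2 * ε₁ + ε₁ = ε := by rw [hε₁]; ring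
    linarith
  have hfin : 3 * c * x ^ 2 ≤ F + Θ := le_of_forall_pos_le_add fun ε hε => by linarith [key ε hε]
  rw [wulff_constant_eq hV0]
  exact hfin

end Summit.Ventures.Crystal3D.Cruxes.PolycrystalWulffBound.PolyDensity

end
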